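import Mathlib
import Summits.CriticalPhenomena.PercolationContinuityZ3.Theorems.PercNearOneGluingNoHeavyLowerTailOrderedDifferencesTwoChain

/-!
# 2-chain periodicity ⟹ the pencil is SEMISIMPLE at `±1` (no Jordan chains): CONJECTURE J at `θ = ±1` for the P2-classes

Helper file for crux `stmt-CriticalPhenomena-4575` (`NoHeavyLowerTail`, route `PercNearOneGluingNoHeavy`), new-inequality factory
seat `prim-ineq-gen-3` (gen 30).  Everything here is PROVED; no definitions.  Imports Mathlib and `…OrderedDifferencesTwoChain`
(`twoChain_of_complClosed`, `twoChain_of_diffs_downClosed`).  Memo: `run/shared/lean/prim/prim-ineq-gen-3/CONJECTURE-J.md` §5.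

The 2-CHAIN PERIODICITY property P2(K) of a family `𝒜` (`λZ = μY ∧ μZ = νY on 𝒜 \\ 𝒜 ⟹ λ = ν`; `…TwoChain`) forbids every eigenvalue
`t` with `t² ≠ 1` (`linearIndependent_pencil_of_twoChain`).  At `t = ±1` the pencil `U(t) = Z + tY` of a family with a complement
pair IS singular; this file shows that P2 still forbids JORDAN CHAINS there: for `θ² = 1` and `2 ≠ 0` in `K`, if `v₀ U(θ) = 0` and
`v₁ U(θ) + v₀ Y = 0` then `v₀ = 0` [the chain is the 2-chain `v₁ → −θv₁ − v₀ → v₁ + 2θ v₀`], and in characteristic `2` a chain of length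
THREE at `θ = 1` is impossible [`v₂ → v₂ + v₁ → v₂ + v₀`] (length two does occur: `{A, Ā}` has invariant factor `(1 + t)²`).  So the
'semisimplicity half' of P2 — CONJECTURE J at `θ = ±1` (memo) — is a THEOREM for every class with P2 in the tree (difference-down-closed,
complement-closed, framed, union-closed, intersection-closed, graphs, almost disjoint, …), over every field of characteristic `≠ 2`.

* `no_chain_of_twoChain` — ★ P2(K), `θ * θ = 1`, `(2 : K) ≠ 0`: no left Jordan chain of length two at `θ`.
* `no_chain_three_of_twoChain_charTwo` — ★ P2(K), characteristic `2`: no left Jordan chain of length three at `1`.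
* `no_chain_of_complClosed` — complement-closed families (the home of the `±1`-eigenvectors): semisimple at `±1` when `2 ≠ 0`.
* `no_chain_of_diffs_downClosed` — difference-down-closed families: the same.
(prim-ineq-gen-3 gen 30, 2026-08-26.)
-/

namespace Summit.CriticalPhenomena.PercolationContinuityZ3.Theorems

namespace OrderedDifferences

open Finset
open scoped FinsetFamily

variable {α : Type*} [DecidableEq α] {K : Type*} [Field K]

/-- **P2 ⟹ no Jordan chain of length two at `θ = ±1`** (when `2 ≠ 0`).  If `𝒜` has the 2-chain periodicity property over `K`,
`θ * θ = 1`, and `v₀ (Z + θY) = 0`, `v₁ (Z + θY) + v₀ Y = 0` on `𝒜 \\ 𝒜`, then `v₀ = 0`. -/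
theorem no_chain_of_twoChain (𝒜 : Finset (Finset α))
    (hP2 : ∀ l m n : ↥𝒜 → K,
      (∀ E ∈ 𝒜 \\ 𝒜, ∑ A : 𝒜, l A * (if E ⊆ (A : Finset α) then (1 : K) else 0) =
        ∑ A : 𝒜, m A * (if Disjoint E (A : Finset α) then (1 : K) else 0)) →
      (∀ E ∈ 𝒜 \\ 𝒜, ∑ A : 𝒜, m A * (if E ⊆ (A : Finset α) then (1 : K) else 0) =
        ∑ A : 𝒜, n A * (if Disjoint E (A : Finset α) then (1 : K) else 0)) → l = n)
    (h2 : (2 : K) ≠ 0) {θ : K} (hθ : θ * θ = 1) (v₀ v₁ : ↥𝒜 → K)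
    (hv₀ : ∀ E ∈ 𝒜 \\ 𝒜, ∑ A : 𝒜, v₀ A *
      ((if E ⊆ (A : Finset α) then (1 : K) else 0) + θ * (if Disjoint E (A : Finset α) then (1 : K) else 0)) = 0)
    (hv₁ : ∀ E ∈ 𝒜 \\ 𝒜, ∑ A : 𝒜, (v₁ A *
      ((if E ⊆ (A : Finset α) then (1 : K) else 0) + θ * (if Disjoint E (A : Finset α) then (1 : K) else 0)) +
        v₀ A * (if Disjoint E (A : Finset α) then (1 : K) else 0)) = 0) :
    v₀ = 0 := by
  -- the 2-chain  v₁ → (−θ v₁ − v₀) → (v₁ + 2θ v₀)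
  have step1 : ∀ E ∈ 𝒜 \\ 𝒜, ∑ A : 𝒜, v₁ A * (if E ⊆ (A : Finset α) then (1 : K) else 0) =
      ∑ A : 𝒜, (-θ * v₁ A - v₀ A) * (if Disjoint E (A : Finset α) then (1 : K) else 0) := by
    intro E hE
    have h := hv₁ E hE
    have e : ∑ A : 𝒜, (v₁ A * ((if E ⊆ (A : Finset α) then (1 : K) else 0) + θ * (if Disjoint E (A : Finset α) then (1 : K) else 0)) +
        v₀ A * (if Disjoint E (A : Finset α) then (1 : K) else 0)) =
        ∑ A : 𝒜, v₁ A * (if E ⊆ (A : Finset α) then (1 : K) else 0) -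
          ∑ A : 𝒜, (-θ * v₁ A - v₀ A) * (if Disjoint E (A : Finset α) then (1 : K) else 0) := by
      rw [← sum_sub_distrib]
      refine sum_congr rfl fun A _ => ?_
      ring
    rw [e] at h
    linear_combination h
  have step2 : ∀ E ∈ 𝒜 \\ 𝒜, ∑ A : 𝒜, (-θ * v₁ A - v₀ A) * (if E ⊆ (A : Finset α) then (1 : K) else 0) =
      ∑ A : 𝒜, (v₁ A + 2 * θ * v₀ A) * (if Disjoint E (A : Finset α) then (1 : K) else 0) := by
    intro E hE
    have h0 := hv₀ E hE
    have h1 := hv₁ E hE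
    have e0 : ∑ A : 𝒜, v₀ A * ((if E ⊆ (A : Finset α) then (1 : K) else 0) + θ * (if Disjoint E (A : Finset α) then (1 : K) else 0)) =
        ∑ A : 𝒜, v₀ A * (if E ⊆ (A : Finset α) then (1 : K) else 0) +
          θ * ∑ A : 𝒜, v₀ A * (if Disjoint E (A : Finset α) then (1 : K) else 0) := by
      rw [mul_sum, ← sum_add_distrib]
      refine sum_congr rfl fun A _ => ?_
      ring
    have e1 : ∑ A : 𝒜, (v₁ A * ((if E ⊆ (A : Finset α) then (1 : K) else 0) + θ * (if Disjoint E (A : Finset α) then (1 : K) else 0)) +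
        v₀ A * (if Disjoint E (A : Finset α) then (1 : K) else 0)) =
        ∑ A : 𝒜, v₁ A * (if E ⊆ (A : Finset α) then (1 : K) else 0) +
          θ * ∑ A : 𝒜, v₁ A * (if Disjoint E (A : Finset α) then (1 : K) else 0) +
          ∑ A : 𝒜, v₀ A * (if Disjoint E (A : Finset α) then (1 : K) else 0) := by
      rw [mul_sum, ← sum_add_distrib, ← sum_add_distrib]
      refine sum_congr rfl fun A _ => ?_
      ring
    rw [e0] at h0
    rw [e1] at h1
    have eL : ∑ A : 𝒜, (-θ * v₁ A - v₀ A) * (if E ⊆ (A : Finset α) then (1 : K) else 0) =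
        -θ * ∑ A : 𝒜, v₁ A * (if E ⊆ (A : Finset α) then (1 : K) else 0) -
          ∑ A : 𝒜, v₀ A * (if E ⊆ (A : Finset α) then (1 : K) else 0) := by
      rw [mul_sum, ← sum_sub_distrib]
      refine sum_congr rfl fun A _ => ?_
      ring
    have eR : ∑ A : 𝒜, (v₁ A + 2 * θ * v₀ A) * (if Disjoint E (A : Finset α) then (1 : K) else 0) =
        ∑ A : 𝒜, v₁ A * (if Disjoint E (A : Finset α) then (1 : K) else 0) +
          2 * θ * ∑ A : 𝒜, v₀ A * (if Disjoint E (A : Finset α) then (1 : K) else 0) := by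
      rw [mul_sum, ← sum_add_distrib]
      refine sum_congr rfl fun A _ => ?_
      ring
    rw [eL, eR]
    linear_combination (-θ) * h1 - h0 + (∑ A : 𝒜, v₁ A * (if Disjoint E (A : Finset α) then (1 : K) else 0)) * hθ
  have h := hP2 v₁ (fun A => -θ * v₁ A - v₀ A) (fun A => v₁ A + 2 * θ * v₀ A) step1 step2
  funext A
  have hA : v₁ A = v₁ A + 2 * θ * v₀ A := congr_fun h A
  have hθ0 : θ ≠ 0 := by
    intro h0
    rw [h0, zero_mul] at hθ
    exact zero_ne_one hθ
  have : 2 * θ * v₀ A = 0 := by linear_combination -hA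
  rcases mul_eq_zero.mp this with h' | h'
  · rcases mul_eq_zero.mp h' with h'' | h''
    · exact absurd h'' h2
    · exact absurd h'' hθ0
  · simpa using h'

/-- **P2 ⟹ no Jordan chain of length three at `1` in characteristic `2`.**  If `𝒜` has the 2-chain periodicity property over a
field `K` of characteristic `2` and `v₁ (Z + Y) + v₀ Y = 0`, `v₂ (Z + Y) + v₁ Y = 0` on `𝒜 \\ 𝒜` (the last two equations of a chain
`(v₀, v₁, v₂)` at `1`; the first, `v₀ (Z + Y) = 0`, is not even needed), then `v₀ = 0`. -/
theorem no_chain_three_of_twoChain_charTwo [CharP K 2] (𝒜 : Finset (Finset α))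
    (hP2 : ∀ l m n : ↥𝒜 → K,
      (∀ E ∈ 𝒜 \\ 𝒜, ∑ A : 𝒜, l A * (if E ⊆ (A : Finset α) then (1 : K) else 0) =
        ∑ A : 𝒜, m A * (if Disjoint E (A : Finset α) then (1 : K) else 0)) →
      (∀ E ∈ 𝒜 \\ 𝒜, ∑ A : 𝒜, m A * (if E ⊆ (A : Finset α) then (1 : K) else 0) =
        ∑ A : 𝒜, n A * (if Disjoint E (A : Finset α) then (1 : K) else 0)) → l = n)
    (v₀ v₁ v₂ : ↥𝒜 → K)
    (hv₁ : ∀ E ∈ 𝒜 \\ 𝒜, ∑ A : 𝒜, (v₁ A *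
      ((if E ⊆ (A : Finset α) then (1 : K) else 0) + (if Disjoint E (A : Finset α) then (1 : K) else 0)) +
        v₀ A * (if Disjoint E (A : Finset α) then (1 : K) else 0)) = 0)
    (hv₂ : ∀ E ∈ 𝒜 \\ 𝒜, ∑ A : 𝒜, (v₂ A *
      ((if E ⊆ (A : Finset α) then (1 : K) else 0) + (if Disjoint E (A : Finset α) then (1 : K) else 0)) +
        v₁ A * (if Disjoint E (A : Finset α) then (1 : K) else 0)) = 0) :
    v₀ = 0 := by
  have h2 : (2 : K) = 0 := by
    have := CharP.cast_eq_zero K 2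
    simpa using this
  -- the 2-chain  v₂ → (v₂ + v₁) → (v₂ + v₀)   (signs are irrelevant in characteristic 2)
  have step1 : ∀ E ∈ 𝒜 \\ 𝒜, ∑ A : 𝒜, v₂ A * (if E ⊆ (A : Finset α) then (1 : K) else 0) =
      ∑ A : 𝒜, (v₂ A + v₁ A) * (if Disjoint E (A : Finset α) then (1 : K) else 0) := by
    intro E hE
    have h := hv₂ E hE
    have e : ∑ A : 𝒜, (v₂ A * ((if E ⊆ (A : Finset α) then (1 : K) else 0) + (if Disjoint E (A : Finset α) then (1 : K) else 0)) +
        v₁ A * (if Disjoint E (A : Finset α) then (1 : K) else 0)) =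
        ∑ A : 𝒜, v₂ A * (if E ⊆ (A : Finset α) then (1 : K) else 0) +
          ∑ A : 𝒜, (v₂ A + v₁ A) * (if Disjoint E (A : Finset α) then (1 : K) else 0) := by
      rw [← sum_add_distrib]
      refine sum_congr rfl fun A _ => ?_
      ring
    rw [e] at h
    linear_combination h - (∑ A : 𝒜, (v₂ A + v₁ A) * (if Disjoint E (A : Finset α) then (1 : K) else 0)) * h2
  have step2 : ∀ E ∈ 𝒜 \\ 𝒜, ∑ A : 𝒜, (v₂ A + v₁ A) * (if E ⊆ (A : Finset α) then (1 : K) else 0) =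
      ∑ A : 𝒜, (v₂ A + v₀ A) * (if Disjoint E (A : Finset α) then (1 : K) else 0) := by
    intro E hE
    have h1 := hv₁ E hE
    have h2' := hv₂ E hE
    have e1 : ∑ A : 𝒜, (v₁ A * ((if E ⊆ (A : Finset α) then (1 : K) else 0) + (if Disjoint E (A : Finset α) then (1 : K) else 0)) +
        v₀ A * (if Disjoint E (A : Finset α) then (1 : K) else 0)) =
        ∑ A : 𝒜, v₁ A * (if E ⊆ (A : Finset α) then (1 : K) else 0) +
          ∑ A : 𝒜, v₁ A * (if Disjoint E (A : Finset α) then (1 : K) else 0) +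
          ∑ A : 𝒜, v₀ A * (if Disjoint E (A : Finset α) then (1 : K) else 0) := by
      rw [← sum_add_distrib, ← sum_add_distrib]
      refine sum_congr rfl fun A _ => ?_
      ring
    have e2 : ∑ A : 𝒜, (v₂ A * ((if E ⊆ (A : Finset α) then (1 : K) else 0) + (if Disjoint E (A : Finset α) then (1 : K) else 0)) +
        v₁ A * (if Disjoint E (A : Finset α) then (1 : K) else 0)) =
        ∑ A : 𝒜, v₂ A * (if E ⊆ (A : Finset α) then (1 : K) else 0) +
          ∑ A : 𝒜, v₂ A * (if Disjoint E (A : Finset α) then (1 : K) else 0) +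
          ∑ A : 𝒜, v₁ A * (if Disjoint E (A : Finset α) then (1 : K) else 0) := by
      rw [← sum_add_distrib, ← sum_add_distrib]
      refine sum_congr rfl fun A _ => ?_
      ring
    rw [e1] at h1
    rw [e2] at h2'
    have eL : ∑ A : 𝒜, (v₂ A + v₁ A) * (if E ⊆ (A : Finset α) then (1 : K) else 0) =
        ∑ A : 𝒜, v₂ A * (if E ⊆ (A : Finset α) then (1 : K) else 0) +
          ∑ A : 𝒜, v₁ A * (if E ⊆ (A : Finset α) then (1 : K) else 0) := by
      rw [← sum_add_distrib]
      refine sum_congr rfl fun A _ => ?_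
      ring
    have eR : ∑ A : 𝒜, (v₂ A + v₀ A) * (if Disjoint E (A : Finset α) then (1 : K) else 0) =
        ∑ A : 𝒜, v₂ A * (if Disjoint E (A : Finset α) then (1 : K) else 0) +
          ∑ A : 𝒜, v₀ A * (if Disjoint E (A : Finset α) then (1 : K) else 0) := by
      rw [← sum_add_distrib]
      refine sum_congr rfl fun A _ => ?_
      ring
    rw [eL, eR]
    linear_combination h2' + h1 -
      (∑ A : 𝒜, v₂ A * (if Disjoint E (A : Finset α) then (1 : K) else 0) +
        ∑ A : 𝒜, v₁ A * (if Disjoint E (A : Finset α) then (1 : K) else 0) +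
        ∑ A : 𝒜, v₀ A * (if Disjoint E (A : Finset α) then (1 : K) else 0)) * h2
  have h := hP2 v₂ (fun A => v₂ A + v₁ A) (fun A => v₂ A + v₀ A) step1 step2
  funext A
  have hA : v₂ A = v₂ A + v₀ A := congr_fun h A
  have : v₀ A = 0 := by linear_combination -hA
  simpa using this

/-- **Complement-closed families are semisimple at `±1`.**  If every member of `𝒜` lies in `S` and `𝒜` is closed under `A ↦ S \ A`
(so `U(±1)` IS singular as soon as `𝒜 ≠ ∅`), then over any field with `2 ≠ 0` the pencil has no Jordan chain of length two at
`θ = ±1`: CONJECTURE J at `±1` holds for complement-closed families. -/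
theorem no_chain_of_complClosed (𝒜 : Finset (Finset α)) (S : Finset α) (hS : ∀ A ∈ 𝒜, A ⊆ S)
    (hc : ∀ A ∈ 𝒜, S \ A ∈ 𝒜) (h2 : (2 : K) ≠ 0) {θ : K} (hθ : θ * θ = 1) (v₀ v₁ : ↥𝒜 → K)
    (hv₀ : ∀ E ∈ 𝒜 \\ 𝒜, ∑ A : 𝒜, v₀ A *
      ((if E ⊆ (A : Finset α) then (1 : K) else 0) + θ * (if Disjoint E (A : Finset α) then (1 : K) else 0)) = 0)
    (hv₁ : ∀ E ∈ 𝒜 \\ 𝒜, ∑ A : 𝒜, (v₁ A *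
      ((if E ⊆ (A : Finset α) then (1 : K) else 0) + θ * (if Disjoint E (A : Finset α) then (1 : K) else 0)) +
        v₀ A * (if Disjoint E (A : Finset α) then (1 : K) else 0)) = 0) :
    v₀ = 0 :=
  no_chain_of_twoChain 𝒜 (fun l m n h1 h2' => twoChain_of_complClosed 𝒜 S hS hc l m n h1 h2') h2 hθ v₀ v₁ hv₀ hv₁

/-- **Difference-down-closed families are semisimple at `±1`** (over any field with `2 ≠ 0`). -/
theorem no_chain_of_diffs_downClosed (𝒜 : Finset (Finset α))
    (hD : ∀ E ∈ 𝒜 \\ 𝒜, ∀ F, F ⊆ E → F ∈ 𝒜 \\ 𝒜) (h2 : (2 : K) ≠ 0) {θ : K} (hθ : θ * θ = 1) (v₀ v₁ : ↥𝒜 → K)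
    (hv₀ : ∀ E ∈ 𝒜 \\ 𝒜, ∑ A : 𝒜, v₀ A *
      ((if E ⊆ (A : Finset α) then (1 : K) else 0) + θ * (if Disjoint E (A : Finset α) then (1 : K) else 0)) = 0)
    (hv₁ : ∀ E ∈ 𝒜 \\ 𝒜, ∑ A : 𝒜, (v₁ A *
      ((if E ⊆ (A : Finset α) then (1 : K) else 0) + θ * (if Disjoint E (A : Finset α) then (1 : K) else 0)) +
        v₀ A * (if Disjoint E (A : Finset α) then (1 : K) else 0)) = 0) :
    v₀ = 0 :=
  no_chain_of_twoChain 𝒜 (fun l m n h1 h2' => twoChain_of_diffs_downClosed 𝒜 hD l m n h1 h2') h2 hθ v₀ v₁ hv₀ hv₁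

end OrderedDifferences

end Summit.CriticalPhenomena.PercolationContinuityZ3.Theorems
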